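import Summits.QuantumFields.YangMills.Theorems.BalabanLadderIRTwistedSlabRepTreeLevel
import Summits.QuantumFields.YangMills.Theorems.BalabanLadderIRTwistedSlabThreshold
import Literature.MathematicalPhysics.QuantumLattice.RepTraceDefectRatio
import HarnessLib

/-!
# T1 FOR `SU(N)` AND EVERY FAITHFUL LATTICE REPRESENTATION `r`, UP TO THE ORDER OF `∃ β₀` AND `∀ L`, MODULO THE ONE-PLAQUETTE
# HESSIAN RATIO (Q): `∃ (ℓ₀, c, C) ∀ L ∃ β₀(L) ∀ β ≥ β₀ ∀ t ≥ 1, projSlabDefect r.ρ ≤ C·L·e^{−ct}` — the r-port of K38 ∕ K39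

HELPER toward stub **T1** `TwistedSlabAnchor` (LINE `twisted-slab-continuity`, crux `IRcof` stmt-QuantumFields-26930, census row 43; pooled
prover ym-ir-line-pool-p3 g17 on director KEY №56; `--supports` the crux, `--as helper`).  Theorems only.  Sequel of `…RepSandwich` (p702041)
and `…RepTreeLevel` (K36's shape for `r.ρ`):
* §4 `twistedSlabAnchor_threshold_of_treeLevel` — K38's mechanism ABSTRACTED ONCE over (compact `G`, central `z`, `zⁿ = 1`, continuous unitary `ρ`,
  a tree-level input of K36's shape): early∕late two-time purity propagation (K35 + K37 via `projSlabDefect_le_of_two_times`); K38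
  (`twistedSlabAnchor_su_threshold`) is its instance at the defining representation — the body is K38's, abstracted, not altered;
* §5 ★★ `twistedSlabAnchor_su_rep_threshold` ∕ ★★ `twistedSlabAnchor_su_rep_threshold_binder` — T1's conclusion for `(SU(N), ω^k, r)`, EVERY
  faithful `r : LatticeRep SU(N)` with (Q) at `κ > 0`, constants `(ℓ₀, c, C)` uniform in `L`, ONLY `β₀ = β₀(L)`; `hessianRatio_fundamental`
  ((Q) at `κ = 1` for `fundamentalLatticeRep N`): K39 is literally the instance `κ = 1` (same statement, by the gate's dedup).
HONEST FRAMING: binder coverage in `r` MODULO (Q) (classical: `κ` = Dynkin-index ratio by Schur on the simple `𝔰𝔲(N)`; not in the tree); the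
transposition `∀L∃β₀ → ∃β₀∀L` (M4, the cluster expansion) and general `G` (BFM) are untouched; T1 0∕1; `IRcof` ∕ `IR` 0∕1; the Yang–Mills mass
gap (Clay) is NOT proved; R4 = `BalabanLadder.UV` only.  References: 't Hooft, NPB 153 (1979) §5; García Pérez–González-Arroyo–Okawa (2014) §3.
-/

set_option autoImplicit false

noncomputable section

open scoped BigOperators Topology Matrix.Norms.L2Operator
open Finset Filter Module
open Literature.MathematicalPhysics.QuantumFieldTheory Literature.MathematicalPhysics.QuantumLattice
open Literature.MathematicalPhysics.QuantumFieldTheory.Balaban1983to89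
open Literature.Barriers.QuantumFields (re_trace_le_of_mem_unitaryGroup eq_one_of_re_trace_eq)

namespace Summit.QuantumFields.YangMills.Cruxes.IRcof.TwistedSlab

/-! ## §4 K38's mechanism, abstracted once: a tree-level input of K36's shape gives T1's bound with `β₀ = β₀(L)` -/

section Generic

variable {G : Type*} [Group G] [TopologicalSpace G] [IsTopologicalGroup G] [CompactSpace G]
  [MeasurableSpace G] [BorelSpace G] [SecondCountableTopology G] {M : ℕ} {ρ : G →* Matrix (Fin M) (Fin M) ℂ}

set_option maxHeartbeats 400000 in
/-- **K38's mechanism, ρ- and G-generic**: for a compact `G`, a continuous unitary `ρ`, a central `z` with `zⁿ = 1` (`n ≥ 1`) and a transverse size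
`ℓ`, a TREE-LEVEL INPUT of K36's shape — `∃ c > 0, C ≥ 0, ∀ L t, ∃ D, projSlabDefect(ρ; β, z, n, ℓ, L, t) → D (β → ∞) ∧ D ≤ C·L·e^{−ct}` —
yields `∃ c' > 0, C' ≥ 0, ∀ L, ∃ β₀(L), ∀ β ≥ β₀, ∀ t ≥ 1, projSlabDefect ≤ C'·L·e^{−c't}` (`c' = c∕2`, `C' = (32∕3)e^{3c}·max(C,1)`): early time
`t₁ ≈ c⁻¹log(8KL)`, late time `t₂ ≈ 2c⁻¹log(4KL)`, two-time purity propagation (K35 + K37, `projSlabDefect_le_of_two_times`).  K38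
(`twistedSlabAnchor_su_threshold`) is this statement at the defining representation of `SU(N)`; the body is K38's, abstracted, not altered.
[cite: tHooft1979Flux, §5 (5.1)–(5.4)] [cite: GarciaperezGonzalezarroyoOkawa2014, §3] -/
theorem twistedSlabAnchor_threshold_of_treeLevel (hρ : Continuous ρ) (hρu : ∀ g, ρ g ∈ Matrix.unitaryGroup (Fin M) ℂ)
    {z : G} (hz : z ∈ Subgroup.center G) {n : ℕ} (hn : 0 < n) (hzn : z ^ n = 1) (ℓ : ℕ)
    (htree : ∃ c C : ℝ, 0 < c ∧ 0 ≤ C ∧ ∀ m₂ m₃ : ℕ, ∃ D : ℝ,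
      Tendsto (fun β : ℝ => projSlabDefect ρ β z n ℓ (m₂ + 1) (m₃ + 1)) atTop (𝓝 D) ∧
        D ≤ C * ((m₂ + 1 : ℕ) : ℝ) * Real.exp (-(c * ((m₃ + 1 : ℕ) : ℝ)))) :
    ∃ c C : ℝ, 0 < c ∧ 0 ≤ C ∧ ∀ m₂ : ℕ, ∃ β₀ : ℝ, ∀ β : ℝ, β₀ ≤ β → ∀ t : ℕ, 1 ≤ t →
      projSlabDefect ρ β z n ℓ (m₂ + 1) t ≤ C * ((m₂ + 1 : ℕ) : ℝ) * Real.exp (-(c * (t : ℝ))) := by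
  obtain ⟨c, C, hc, hC0, hlim⟩ := htree
  set K : ℝ := max C 1 with hKdef
  have hK1 : 1 ≤ K := le_max_right _ _
  have hCK : C ≤ K := le_max_left _ _
  have hK0 : 0 < K := lt_of_lt_of_le one_pos hK1
  refine ⟨c / 2, 32 / 3 * Real.exp (3 * c) * K, by positivity, by positivity, fun m₂ => ?_⟩
  set L : ℝ := ((m₂ + 1 : ℕ) : ℝ) with hLdef
  have hL1 : 1 ≤ L := by rw [hLdef]; exact_mod_cast Nat.succ_pos m₂
  have hKL : 1 ≤ K * L := one_le_mul_of_one_le_of_one_le hK1 hL1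
  have hKL0 : 0 < K * L := by positivity
  -- the early and the late time
  set x₁ : ℝ := Real.log (8 * (K * L)) / c with hx₁def
  set x₂ : ℝ := 2 * Real.log (4 * (K * L)) / c with hx₂def
  have hlog8 : 0 ≤ Real.log (8 * (K * L)) := Real.log_nonneg (by linarith)
  have hlog4 : 0 ≤ Real.log (4 * (K * L)) := Real.log_nonneg (by linarith)
  have hx₁ : 0 ≤ x₁ := div_nonneg hlog8 hc.le
  have hx₂ : 0 ≤ x₂ := div_nonneg (by positivity) hc.le
  set t₁ : ℕ := ⌈x₁⌉₊ + 2 with ht₁def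
  set t₂ : ℕ := ⌈x₂⌉₊ + 2 with ht₂def
  have ht₁2 : 2 ≤ t₁ := by omega
  have ht₂2 : 2 ≤ t₂ := by omega
  have ht₁ge : x₁ ≤ (t₁ : ℝ) := by
    rw [ht₁def]; push_cast; linarith [Nat.le_ceil x₁]
  have ht₁lt : ((t₁ : ℝ) - 1) ≤ x₁ + 2 := by
    rw [ht₁def]; push_cast; linarith [Nat.ceil_lt_add_one hx₁]
  have ht₂ge : x₂ ≤ (t₂ : ℝ) := by
    rw [ht₂def]; push_cast; linarith [Nat.le_ceil x₂]
  -- exponential consequences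
  have hct₁ : Real.log (8 * (K * L)) ≤ c * t₁ := by
    have := mul_le_mul_of_nonneg_left ht₁ge hc.le
    rwa [hx₁def, mul_div_cancel₀ _ hc.ne'] at this
  have he₁ : K * L * Real.exp (-(c * t₁)) ≤ 1 / 8 := by
    rw [Real.exp_neg]
    have h : 8 * (K * L) ≤ Real.exp (c * t₁) := by
      calc 8 * (K * L) = Real.exp (Real.log (8 * (K * L))) := (Real.exp_log (by positivity)).symm
        _ ≤ Real.exp (c * t₁) := Real.exp_le_exp.2 hct₁
    rw [mul_inv_le_iff₀ (Real.exp_pos _)]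
    linarith
  have he₁' : Real.exp (c * ((t₁ : ℝ) - 1)) ≤ 8 * (K * L) * Real.exp (2 * c) := by
    have h : c * ((t₁ : ℝ) - 1) ≤ Real.log (8 * (K * L)) + 2 * c := by
      have := mul_le_mul_of_nonneg_left ht₁lt hc.le
      rw [hx₁def, mul_add, mul_div_cancel₀ _ hc.ne'] at this
      linarith
    calc Real.exp (c * ((t₁ : ℝ) - 1)) ≤ Real.exp (Real.log (8 * (K * L)) + 2 * c) := Real.exp_le_exp.2 h
      _ = 8 * (K * L) * Real.exp (2 * c) := by rw [Real.exp_add, Real.exp_log (by positivity)]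
  have hct₂ : Real.log (4 * (K * L)) ≤ c * t₂ / 2 := by
    have := mul_le_mul_of_nonneg_left ht₂ge hc.le
    rw [hx₂def, mul_div_cancel₀ _ hc.ne'] at this
    linarith
  -- the late slack `δ₂ := 2 K L e^{−c t₂} ≤ 1/8`
  set δ₂ : ℝ := 2 * (K * L * Real.exp (-(c * t₂))) with hδ₂def
  have hδ₂pos : 0 < δ₂ := by positivity
  have hδ₂le : δ₂ ≤ 1 / 8 := by
    have h : (4 * (K * L)) ^ 2 ≤ Real.exp (c * t₂) := by
      calc (4 * (K * L)) ^ 2 = Real.exp (2 * Real.log (4 * (K * L))) := by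
            rw [← Real.rpow_natCast, Real.rpow_def_of_pos (by positivity)]; ring_nf
        _ ≤ Real.exp (c * t₂) := Real.exp_le_exp.2 (by linarith)
    rw [hδ₂def, Real.exp_neg]
    have h16 : 16 * (K * L) ≤ (4 * (K * L)) ^ 2 := by nlinarith
    have hexp : 0 < Real.exp (c * t₂) := Real.exp_pos _
    calc 2 * (K * L * (Real.exp (c * t₂))⁻¹) = 2 * (K * L) / Real.exp (c * t₂) := by ring
      _ ≤ 2 * (K * L) / (16 * (K * L)) := by gcongr; linarith
      _ = 1 / 8 := by field_simp; ring
  have hδ₂half : δ₂ < 1 / 2 := by linarith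
  -- the rate read at `t₂`: `(δ₂/(1−δ₂))^{1/t₂} ≤ e^{−c/2}`
  have hρ₂ : (δ₂ / (1 - δ₂)) ^ (1 / (t₂ : ℝ)) ≤ Real.exp (-(c / 2)) := by
    have hu0 : 0 < δ₂ / (1 - δ₂) := div_pos hδ₂pos (by linarith)
    have hu : δ₂ / (1 - δ₂) ≤ 4 * (K * L) * Real.exp (-(c * t₂)) := by
      rw [div_le_iff₀ (by linarith)]
      have : 0 ≤ K * L * Real.exp (-(c * t₂)) := by positivity
      nlinarith
    have ht₂pos : (0 : ℝ) < t₂ := by exact_mod_cast (show 0 < t₂ by omega)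
    rw [Real.rpow_def_of_pos hu0]
    refine Real.exp_le_exp.2 ?_
    have hlogu : Real.log (δ₂ / (1 - δ₂)) ≤ Real.log (4 * (K * L)) - c * t₂ := by
      calc Real.log (δ₂ / (1 - δ₂)) ≤ Real.log (4 * (K * L) * Real.exp (-(c * t₂))) := Real.log_le_log hu0 hu
        _ = Real.log (4 * (K * L)) - c * t₂ := by
            rw [Real.log_mul (by positivity) (Real.exp_pos _).ne', Real.log_exp]; ring
    have h1 : Real.log (δ₂ / (1 - δ₂)) ≤ -(c * t₂ / 2) := by linarith
    calc Real.log (δ₂ / (1 - δ₂)) * (1 / (t₂ : ℝ)) ≤ -(c * t₂ / 2) * (1 / (t₂ : ℝ)) :=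
          mul_le_mul_of_nonneg_right h1 (by positivity)
      _ = -(c / 2) := by field_simp
  have hρ₂0 : 0 ≤ (δ₂ / (1 - δ₂)) ^ (1 / (t₂ : ℝ)) := Real.rpow_nonneg (div_nonneg hδ₂pos.le (by linarith)) _
  -- the two classical limits and the threshold `β₀(L)`
  obtain ⟨D₁, hT₁, hD₁⟩ := hlim m₂ (t₁ - 1)
  obtain ⟨D₂, hT₂, hD₂⟩ := hlim m₂ (t₂ - 1)
  have ht₁eq : t₁ - 1 + 1 = t₁ := by omega
  have ht₂eq : t₂ - 1 + 1 = t₂ := by omega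
  rw [ht₁eq] at hT₁ hD₁
  rw [ht₂eq] at hT₂ hD₂
  have hD₁' : D₁ < 1 / 4 := by
    have h : C * L * Real.exp (-(c * t₁)) ≤ K * L * Real.exp (-(c * t₁)) := by gcongr
    linarith
  have hD₂' : D₂ < δ₂ := by
    have h : C * L * Real.exp (-(c * t₂)) ≤ K * L * Real.exp (-(c * t₂)) := by gcongr
    have h0 : 0 < K * L * Real.exp (-(c * t₂)) := by positivity
    linarith
  have hev := (hT₁.eventually (Iic_mem_nhds hD₁')).and ((hT₂.eventually (Iic_mem_nhds hD₂')).and (eventually_ge_atTop (0 : ℝ)))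
  obtain ⟨β₀, hβ₀⟩ := hev.exists_forall_of_atTop
  refine ⟨β₀, fun β hβ t ht => ?_⟩
  obtain ⟨h1, h2, hβ0⟩ := hβ₀ β hβ
  have hprop := projSlabDefect_le_of_two_times hρ hρu hβ0
    hz hn hzn ℓ (m₂ + 1) ht₁2 ht₂2 (δ₁ := 1 / 4) (by norm_num) hδ₂pos.le hδ₂half h1 h2
  rcases Nat.lt_or_ge t t₁ with hlt | hge
  · -- early times: the defect is `≤ 1 ≤ C' L e^{−(c/2)t}`
    have htle : (t : ℝ) ≤ (t₁ : ℝ) - 1 := by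
      have h' : ((t + 1 : ℕ) : ℝ) ≤ t₁ := by exact_mod_cast hlt
      push_cast at h'; linarith
    have ha : c * (t : ℝ) ≤ c * ((t₁ : ℝ) - 1) := mul_le_mul_of_nonneg_left htle hc.le
    have hb : 0 ≤ c * (t : ℝ) := by positivity
    have hA : 1 ≤ Real.exp (-(c / 2 * (t : ℝ))) * (8 * (K * L) * Real.exp (2 * c)) := by
      have h1 : Real.exp (-(c * ((t₁ : ℝ) - 1))) ≤ Real.exp (-(c / 2 * (t : ℝ))) := Real.exp_le_exp.2 (by linarith)
      have h2 : Real.exp (-(c * ((t₁ : ℝ) - 1))) * Real.exp (c * ((t₁ : ℝ) - 1)) = 1 := by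
        rw [← Real.exp_add]; norm_num
      calc (1 : ℝ) = Real.exp (-(c * ((t₁ : ℝ) - 1))) * Real.exp (c * ((t₁ : ℝ) - 1)) := h2.symm
        _ ≤ Real.exp (-(c / 2 * (t : ℝ))) * (8 * (K * L) * Real.exp (2 * c)) := by gcongr
    have hsplit : Real.exp (3 * c) = Real.exp c * Real.exp (2 * c) := by rw [← Real.exp_add]; ring_nf
    have hec : 1 ≤ Real.exp c := Real.one_le_exp hc.le
    calc projSlabDefect ρ β z n ℓ (m₂ + 1) t ≤ 1 :=
          projSlabDefect_le_one ρ β z n ℓ _ t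
      _ ≤ 4 / 3 * Real.exp c * 1 := by linarith
      _ ≤ 4 / 3 * Real.exp c * (Real.exp (-(c / 2 * (t : ℝ))) * (8 * (K * L) * Real.exp (2 * c))) := by gcongr
      _ = 32 / 3 * Real.exp (3 * c) * K * L * Real.exp (-(c / 2 * (t : ℝ))) := by rw [hsplit]; ring
  · -- late times: two-time propagation
    have hmain := hprop t hge
    have hpow : ((δ₂ / (1 - δ₂)) ^ (1 / (t₂ : ℝ))) ^ (t - t₁) ≤ Real.exp (-(c / 2)) ^ (t - t₁) :=
      pow_le_pow_left₀ hρ₂0 hρ₂ _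
    have hexp2 : Real.exp (-(c / 2)) ^ (t - t₁) = Real.exp (c / 2 * t₁) * Real.exp (-(c / 2 * (t : ℝ))) := by
      rw [← Real.exp_nat_mul, ← Real.exp_add, Nat.cast_sub hge]; ring_nf
    have h13 : 2 * ((1 : ℝ) / 4 / (1 - 1 / 4)) = 2 / 3 := by norm_num
    rw [h13] at hmain
    have ht₁0 : 0 ≤ c * (t₁ : ℝ) := by positivity
    have het₁ : Real.exp (c / 2 * t₁) ≤ 8 * (K * L) * Real.exp (3 * c) := by
      calc Real.exp (c / 2 * t₁) ≤ Real.exp (c * ((t₁ : ℝ) - 1) + c) := Real.exp_le_exp.2 (by linarith)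
        _ = Real.exp (c * ((t₁ : ℝ) - 1)) * Real.exp c := Real.exp_add _ _
        _ ≤ 8 * (K * L) * Real.exp (2 * c) * Real.exp c := by gcongr
        _ = 8 * (K * L) * Real.exp (3 * c) := by rw [mul_assoc, ← Real.exp_add]; ring_nf
    have hX : 0 ≤ Real.exp (3 * c) * K * L * Real.exp (-(c / 2 * (t : ℝ))) := by positivity
    calc projSlabDefect ρ β z n ℓ (m₂ + 1) t
        ≤ 2 / 3 * ((δ₂ / (1 - δ₂)) ^ (1 / (t₂ : ℝ))) ^ (t - t₁) := hmain
      _ ≤ 2 / 3 * (Real.exp (c / 2 * t₁) * Real.exp (-(c / 2 * (t : ℝ)))) := by rw [← hexp2]; gcongr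
      _ ≤ 2 / 3 * (8 * (K * L) * Real.exp (3 * c) * Real.exp (-(c / 2 * (t : ℝ)))) := by gcongr
      _ = 16 / 3 * Real.exp (3 * c) * K * L * Real.exp (-(c / 2 * (t : ℝ))) := by ring
      _ ≤ 32 / 3 * Real.exp (3 * c) * K * L * Real.exp (-(c / 2 * (t : ℝ))) := by linarith


end Generic

/-! ## §5 T1 for `(SU(N), ω^k, r)` up to `∀L∃β₀`, every faithful `r` with a Hessian ratio; the defining representation as the instance `κ = 1` -/

section Rep

variable {N : ℕ} [NeZero N] {k : ZMod N}

/-- ★★ **T1 FOR `SU(N)` AND EVERY FAITHFUL `r`, UP TO THE ORDER OF `∃ β₀` AND `∀ L`, MODULO (Q).**  For `N ≥ 2`, `k` a unit (`z = ω^k·1`),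
`n ≥ 1` with `z^n = 1`, every `ℓ₀ = m + 1`, every `r : LatticeRep SU(N)` and `κ > 0` with the one-plaquette Hessian ratio (Q): there are `c > 0`,
`C ≥ 0` (K36's constants up to K38's explicit factors; depending on `N, m` ONLY — the Dynkin index cancels) such that for EVERY `L = m₂ + 1` there
is `β₀ = β₀(L, r)` with `projSlabDefect(r.ρ; β, z, n, ℓ₀, L, t) ≤ C·L·e^{−ct}` for ALL `β ≥ β₀`, `t ≥ 1`.  HONEST: `β₀` depends on `L`; T1 NOT proved.
[cite: tHooft1979Flux, §5 (5.1)–(5.4)] [cite: GarciaperezGonzalezarroyoOkawa2014, §3] -/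
theorem twistedSlabAnchor_su_rep_threshold (hN : 2 ≤ N) (hk : IsUnit k) {n : ℕ} (hn : 0 < n) (hzn : (suCenter N k : Matrix.specialUnitaryGroup (Fin N) ℂ) ^ n = 1)
    (r : LatticeRep (Matrix.specialUnitaryGroup (Fin N) ℂ)) {κ : ℝ} (hκ : 0 < κ)
    (hQ : Tendsto (fun h : Matrix.specialUnitaryGroup (Fin N) ℂ =>
      ((r.N : ℝ) - (r.ρ h).trace.re) / ((N : ℝ) - (fundamentalRep (Fin N) h).trace.re)) (𝓝[≠] 1) (𝓝 κ))
    (m : ℕ) :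
    ∃ c C : ℝ, 0 < c ∧ 0 ≤ C ∧ ∀ m₂ : ℕ, ∃ β₀ : ℝ, ∀ β : ℝ, β₀ ≤ β → ∀ t : ℕ, 1 ≤ t →
      projSlabDefect r.ρ β (suCenter N k : Matrix.specialUnitaryGroup (Fin N) ℂ) n (m + 1) (m₂ + 1) t ≤ C * ((m₂ + 1 : ℕ) : ℝ) * Real.exp (-(c * (t : ℝ))) :=
  twistedSlabAnchor_threshold_of_treeLevel r.continuous r.mem_unitary (suCenter N k).2 hn hzn (m + 1)
    (treeLevel_uniform_rep hN hk hn hzn r hκ hQ m)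

/-- ★★ **The same in the stub's LITERAL binder shape** (`TwistedSlabAnchor`'s body for `(SU(N), ω^k·1, r)` VERBATIM except that `∃ β₀` sits after
`∀ L`; `ℓ₀ = 2`): `∃ ℓ₀ c C, 2 ≤ ℓ₀ ∧ 0 < c ∧ ∀ L ≥ 2, ∃ β₀, ∀ β ≥ β₀, ∀ t ≥ 1, projSlabDefect r.ρ β z n ℓ₀ L t ≤ C·L·e^{−ct}` — every faithful
`r` with (Q).  HONEST: the transposition `∀L∃β₀ → ∃β₀∀L` is M4 (not in print); (Q) is a hypothesis. [cite: tHooft1979Flux, §5 (5.1)–(5.4)] -/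
theorem twistedSlabAnchor_su_rep_threshold_binder (hN : 2 ≤ N) (hk : IsUnit k) {n : ℕ} (hn : 0 < n) (hzn : (suCenter N k : Matrix.specialUnitaryGroup (Fin N) ℂ) ^ n = 1)
    (r : LatticeRep (Matrix.specialUnitaryGroup (Fin N) ℂ)) {κ : ℝ} (hκ : 0 < κ)
    (hQ : Tendsto (fun h : Matrix.specialUnitaryGroup (Fin N) ℂ =>
      ((r.N : ℝ) - (r.ρ h).trace.re) / ((N : ℝ) - (fundamentalRep (Fin N) h).trace.re)) (𝓝[≠] 1) (𝓝 κ)) :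
    ∃ (ℓ₀ : ℕ) (c C : ℝ), 2 ≤ ℓ₀ ∧ 0 < c ∧
      ∀ L : ℕ, 2 ≤ L → ∃ β₀ : ℝ, ∀ β : ℝ, β₀ ≤ β → ∀ t : ℕ, 1 ≤ t →
        projSlabDefect r.ρ β (suCenter N k : Matrix.specialUnitaryGroup (Fin N) ℂ) n ℓ₀ L t ≤ C * (L : ℝ) * Real.exp (-(c * (t : ℝ))) := by
  obtain ⟨c, C, hc, -, h⟩ := twistedSlabAnchor_su_rep_threshold hN hk hn hzn r hκ hQ 1
  refine ⟨2, c, C, le_rfl, hc, fun L hL => ?_⟩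
  obtain ⟨m₂, rfl⟩ : ∃ m₂, L = m₂ + 1 := ⟨L - 1, by omega⟩
  obtain ⟨β₀, hβ₀⟩ := h m₂
  exact ⟨β₀, fun β hβ t ht => hβ₀ β hβ t ht⟩

/-- The defining representation has Hessian ratio `κ = 1` (the ratio is identically `1` off `h = 1`). [folklore] -/
theorem hessianRatio_fundamental (N : ℕ) :
    Tendsto (fun h : Matrix.specialUnitaryGroup (Fin N) ℂ =>
        (((fundamentalLatticeRep N).N : ℝ) - ((fundamentalLatticeRep N).ρ h).trace.re) /
          ((N : ℝ) - (fundamentalRep (Fin N) h).trace.re))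
      (𝓝[≠] 1) (𝓝 1) := by
  refine (tendsto_const_nhds (x := (1 : ℝ))).congr' ?_
  filter_upwards [self_mem_nhdsWithin] with h hh
  have hne : (N : ℝ) - (fundamentalRep (Fin N) h).trace.re ≠ 0 := by
    intro h0
    have htr : (fundamentalRep (Fin N) h).trace.re = N := by linarith
    have h1 : fundamentalRep (Fin N) h = 1 := eq_one_of_re_trace_eq (fundamentalRep_mem_unitaryGroup h) htr
    exact hh (fundamentalRep_injective (Fin N) (by rw [h1, map_one]))
  change (1 : ℝ) = (((fundamentalLatticeRep N).N : ℝ) - ((fundamentalLatticeRep N).ρ h).trace.re) /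
    ((N : ℝ) - (fundamentalRep (Fin N) h).trace.re)
  rw [eq_comm, div_eq_one_iff_eq hne]
  rfl


/-! **K38∕K39 are the instance `κ = 1`:** `twistedSlabAnchor_su_rep_threshold_binder hN hk hn hzn (fundamentalLatticeRep N) one_pos
(hessianRatio_fundamental N)` has EXACTLY the statement of K39 `twistedSlabAnchor_su_fundamental_threshold` (the gate's dedup lint identifies
them; not re-declared here). -/

/-! ## §6 (Q) DISCHARGED BY NAME — T1 for `(SU(N), ω^k, r)` up to `∀L∃β₀`, UNCONDITIONAL in the lattice representation `r`
(appended 2026-08-29 after lit-4's `Literature/MathematicalPhysics/QuantumLattice/RepTraceDefectRatio.lean`, p703441: the one-plaquette Hessian ratio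
(Q) holds for EVERY `r : LatticeRep SU(N)` — derived map (Hall Thm 3.28) + Schur on the simple `𝔰𝔲(N)`, `κ` = Dynkin index in HS units) -/

/-- ★★★ **T1 FOR `(SU(N), ω^k·1, r)` UP TO THE ORDER OF `∃ β₀` AND `∀ L`, FOR EVERY LATTICE REPRESENTATION `r` OF `SU(N)` — NO HYPOTHESIS.**
`N ≥ 2`, `k` a unit, `n ≥ 1` with `(ω^k·1)^n = 1`, `r : LatticeRep SU(N)` (faithful, unitary, continuous):
`∃ ℓ₀ c C, 2 ≤ ℓ₀ ∧ 0 < c ∧ ∀ L ≥ 2, ∃ β₀, ∀ β ≥ β₀, ∀ t ≥ 1, projSlabDefect r.ρ β (ω^k·1) n ℓ₀ L t ≤ C·L·e^{−ct}` — `TwistedSlabAnchor`'s body for this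
`(G, z, r)` VERBATIM except that `∃ β₀` sits after `∀ L`.  (Q) is fed BY NAME: `LatticeRep.exists_tendsto_traceDefect_ratio_fin` (lit-4 L37).
HONEST: the transposition `∀L∃β₀ → ∃β₀∀L` (M4, the `L`-uniform weak-coupling cluster expansion) is NOT proved; T1's `∀ G` binder (BFM) untouched;
T1 0∕1; `IRcof` ∕ `IR` 0∕1; the Yang–Mills mass gap (Clay) is NOT proved. [cite: tHooft1979Flux, §5 (5.1)–(5.4)] [cite: Hall2015, Thm. 3.28] -/
theorem twistedSlabAnchor_su_rep_threshold_all (hN : 2 ≤ N) (hk : IsUnit k) {n : ℕ} (hn : 0 < n) (hzn : (suCenter N k : Matrix.specialUnitaryGroup (Fin N) ℂ) ^ n = 1)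
    (r : LatticeRep (Matrix.specialUnitaryGroup (Fin N) ℂ)) :
    ∃ (ℓ₀ : ℕ) (c C : ℝ), 2 ≤ ℓ₀ ∧ 0 < c ∧
      ∀ L : ℕ, 2 ≤ L → ∃ β₀ : ℝ, ∀ β : ℝ, β₀ ≤ β → ∀ t : ℕ, 1 ≤ t →
        projSlabDefect r.ρ β (suCenter N k : Matrix.specialUnitaryGroup (Fin N) ℂ) n ℓ₀ L t ≤ C * (L : ℝ) * Real.exp (-(c * (t : ℝ))) := by
  obtain ⟨κ, hκ, hQ⟩ := r.exists_tendsto_traceDefect_ratio_fin (le_trans one_le_two hN)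
  exact twistedSlabAnchor_su_rep_threshold_binder hN hk hn hzn r hκ hQ

/-- ★★ The threshold form with K36∕K38's `L`-uniform constants `(c, C)` at every transverse size `ℓ₀ = m + 1`, for EVERY `r : LatticeRep SU(N)`, no
hypothesis: `∃ c > 0, C ≥ 0, ∀ L = m₂+1, ∃ β₀, ∀ β ≥ β₀, ∀ t ≥ 1, projSlabDefect r.ρ β (ω^k·1) n (m+1) L t ≤ C·L·e^{−ct}`.
[cite: tHooft1979Flux, §5 (5.1)–(5.4)] [cite: Hall2015, Thm. 3.28] -/
theorem twistedSlabAnchor_su_rep_threshold_all' (hN : 2 ≤ N) (hk : IsUnit k) {n : ℕ} (hn : 0 < n) (hzn : (suCenter N k : Matrix.specialUnitaryGroup (Fin N) ℂ) ^ n = 1)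
    (r : LatticeRep (Matrix.specialUnitaryGroup (Fin N) ℂ)) (m : ℕ) :
    ∃ c C : ℝ, 0 < c ∧ 0 ≤ C ∧ ∀ m₂ : ℕ, ∃ β₀ : ℝ, ∀ β : ℝ, β₀ ≤ β → ∀ t : ℕ, 1 ≤ t →
      projSlabDefect r.ρ β (suCenter N k : Matrix.specialUnitaryGroup (Fin N) ℂ) n (m + 1) (m₂ + 1) t ≤ C * ((m₂ + 1 : ℕ) : ℝ) * Real.exp (-(c * (t : ℝ))) := by
  obtain ⟨κ, hκ, hQ⟩ := r.exists_tendsto_traceDefect_ratio_fin (le_trans one_le_two hN)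
  exact twistedSlabAnchor_su_rep_threshold hN hk hn hzn r hκ hQ m

end Rep

end Summit.QuantumFields.YangMills.Cruxes.IRcof.TwistedSlab

end
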